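import Literature.AlgebraicGeometry.Motives.AbelianVarietyGoodReductionReductionMap
import Literature.AlgebraicGeometry.Motives.AbelianVarietyFrobeniusTwistPoints
import HarnessLib

/-!
# The reduction point of the Frobenius-conjugate datum is the relative Frobenius of the reduction point
# — [Shimura 1998, §18.6 proof of Thm. 18.6, p. 129 «`(Y^σ)~ = Ỹ^f` … `(t^σ)~ = π(t̃)`»]

Topic `Literature/AlgebraicGeometry/Motives`; namespaces `Literature.AlgebraicGeometry.Motives` (§0 first lemma, §1) and
`Literature.AlgebraicGeometry.Motives.AbelianVariety.GoodReductionAt` (§0, §2).  THEOREMS ONLY (no definition, no named fact;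
net Literature debt 0).  Cell `hodgecm-mathlib` (D-0151), row II-1, edition E4 «S5c′ ↦ Q5», Q5 background pool piece
**(P4) «conjReductionIso reading»** (B-p09 ruling 2026-08-28T09:32:18Z (3); slot text B-p07 09:30:48Z verbatim).

WHAT IS HERE.
* §0 — `.left`-level readings of the layers of the reduction map of a good-reduction datum (file
  `AbelianVarietyGoodReductionReductionMap`): the transpose of the adjunction `Over.map ⊣ Over.pullback` has first
  component the given map (`mapPullbackAdj_homEquiv_left_comp_fst`); the model point of `Q ∈ B(K̄ᵥ)` lies over the
  generic-fibre point `e'⁻¹(Q)` (`modelPointsEquiv_symm_left`); the reduction point read in the special fibre lies over the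
  re-based residue point (`reductionPoint_comp_reductionIso'_hom_left_comp_fst`); points of `S.reduction` are determined by
  that reading (`reduction_points_ext`).
* §1 — the absolute Frobenius commutes with every morphism between spectra of fields (`specMap_iterateFrobenius_comp`,
  the tree's `powEndo_comp`).
* §2 — **`GoodReductionAt.reductionPoint_conjOfSquares_eq_relFrobenius`**: for the conjugate datum
  `R'.conjOfSquares γ γᵥ h₁ p n h₂` of ANY good-reduction datum `R'` (model `𝒳 ⊗_{γᵥ} 𝓞ᵥ`, reduction `Ã^{(q)}` ON THE NOSE,
  reduction isomorphism `conjReductionIso`), a `κ(R)`-point `z` of the twisted model whose projection to `𝒳` is the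
  `Frobⁿ`-translate of a `κ(R)`-point `w` of `𝒳` REDUCES to `π(w̄)`, `π = F^{(n)}_{Ã/κ} : Ã → Ã^{(q)}` the relative
  Frobenius: `(R'.conjOfSquares …).reductionPoint z = π (R'.reductionPoint w)` — Shimura's «`(t^σ)~ = π(t̃)`» at the level
  of the special fibre ([Shimura1998] p. 129–130; Milne, *Étale cohomology* VI §13: `F` raises coordinates to the `q`-th
  power).  A corollary of the tree's point-level reading `map_relFrobenius_eq_of_conjReductionIso` and the projection
  formula `conjReductionIso_hom_left_comp_fst_fst` (file `AbelianVarietyFrobeniusTwistPoints`) and of §0.  This is slot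
  (P4) of the (TW) assembly (B-p07 `Q5-TW-harness.lean`).

HC_CM is proved only modulo the 7 printed citations until rung 0 closes.

## References
* [Shimura1998] G. Shimura, *Abelian Varieties with Complex Multiplication and Modular Functions*, Princeton 1998, §18.6
  proof of Thm. 18.6, pp. 129–130.
* [GortzWedhorn2020] U. Görtz, T. Wedhorn, *Algebraic Geometry I* (2nd ed.), Prop. 4.16 and §(4.7)–(4.8).
* [Hartshorne1977] R. Hartshorne, *Algebraic Geometry*, II.3 (fibre products), IV §2 Rem. 2.4.1 (Frobenius).
-/

set_option autoImplicit false

noncomputable section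

open CategoryTheory CategoryTheory.Limits AlgebraicGeometry IsDedekindDomain IsDedekindDomain.HeightOneSpectrum
open scoped NumberField
open Literature.NumberTheory.EllipticCurves (genericFibre specGenericPoint)
open Literature.NumberTheory.GaloisRepresentations (closureValuationSubring)
open Literature.NumberTheory.DiophantineGeometry

namespace Literature.AlgebraicGeometry.Motives

universe u

/-! ### §0 `.left`-level readings of the layers of the reduction map -/

set_option backward.isDefEq.respectTransparency false in
/-- The transpose `(u, U → S') : U → 𝒳 ×_S S'` of `u : U → 𝒳` along Mathlib's `Over.mapPullbackAdj` has first component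
`u`, on underlying schemes. [cite: Hartshorne1977, II.3 Thm. 3.3 (fibre product, universal property)] -/
@[reassoc]
theorem mapPullbackAdj_homEquiv_left_comp_fst {S S' : Scheme.{u}} (g : S' ⟶ S) (U : Over S') (𝒳 : Over S)
    (u : (Over.map g).obj U ⟶ 𝒳) :
    ((Over.mapPullbackAdj g).homEquiv U 𝒳 u).left ≫ pullback.fst 𝒳.hom g = u.left := by
  simp [Over.mapPullbackAdj]

namespace AbelianVariety

namespace GoodReductionAt

variable {K : Type} [Field K] [NumberField K] {v : HeightOneSpectrum (𝓞 K)} {B : AbelianVariety K}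

/-- **The model point of `Q ∈ B(K̄ᵥ)` lies over the generic-fibre point `e'⁻¹(Q)`**: on underlying schemes,
`(S.modelPointsEquiv⁻¹ Q).left = (Q ≫ (S.genericIso')⁻¹).left ≫ pr₁`, `pr₁ : 𝒳_K → 𝒳` the first projection.
[cite: Hartshorne1977, II.3 Thm. 3.3 (fibre product, universal property)] -/
theorem modelPointsEquiv_symm_left (S : B.GoodReductionAt v) (Q : B.Points (AlgebraicClosure (v.adicCompletion K))) :
    (S.modelPointsEquiv.symm Q).left =
      (Q ≫ S.genericIso'.inv).left ≫ pullback.fst S.model.total.hom (specGenericPoint (valuationSubringAtPrime K v) K) := by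
  set P := S.modelPointsEquiv.symm Q with hP
  have hQ : S.modelPointsEquiv P = Q := S.modelPointsEquiv.apply_symm_apply Q
  rw [modelPointsEquiv_apply] at hQ
  have hQ' : Q ≫ S.genericIso'.inv =
      (Over.mapPullbackAdj (specGenericPoint (valuationSubringAtPrime K v) K)).homEquiv _ S.model.total
        ((specFractionFieldIso v).inv ≫ P) := by
    rw [← hQ, Category.assoc, Iso.hom_inv_id, Category.comp_id]
  rw [hQ', mapPullbackAdj_homEquiv_left_comp_fst, Over.comp_left]
  change P.left = (Iso.refl _).inv ≫ P.left
  rw [Iso.refl_inv, Category.id_comp]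

/-- **The reduction point, read in the special fibre, lies over the re-based residue point**:
`(S.reductionPoint y ≫ S.reductionIso').left ≫ pr₁ = (Spec κ̄(v) ≅ Spec κ(R)) ≫ y.left`, `pr₁ : 𝒳_v → 𝒳`.
[cite: Hartshorne1977, II.3 Thm. 3.3 (fibre product, universal property)] -/
theorem reductionPoint_comp_reductionIso'_hom_left_comp_fst (S : B.GoodReductionAt v)
    (y : residueFieldPoints S.model.total) :
    (S.reductionPoint y ≫ S.reductionIso'.hom).left ≫ pullback.fst S.model.total.hom (specResidueField v) =
      (geomClosedPointIso v).inv.left ≫ (geomClosedPointIsoSpecResidueField v).inv.left ≫ y.left := by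
  rw [reductionPoint, Category.assoc, Iso.inv_hom_id, Category.comp_id, mapPullbackAdj_homEquiv_left_comp_fst,
    Over.comp_left, Over.comp_left]

/-- Two points of the reduction `S.reduction` with values in a field `L ⊇ κ(v)` agree as soon as, read in the special fibre
`𝒳_v` through `S.reductionIso'`, their composites with `pr₁ : 𝒳_v → 𝒳` agree (universal property of the fibre product:
the second components are the structure maps). [cite: GortzWedhorn2020, Section (4.7)] -/
theorem reduction_points_ext (S : B.GoodReductionAt v) {L : Type} [Field L] [Algebra v.asIdeal.ResidueField L]
    {Q₁ Q₂ : S.reduction.Points L}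
    (h : (Q₁ ≫ S.reductionIso'.hom).left ≫ pullback.fst S.model.total.hom (specResidueField v) =
      (Q₂ ≫ S.reductionIso'.hom).left ≫ pullback.fst S.model.total.hom (specResidueField v)) : Q₁ = Q₂ := by
  have h' : Q₁ ≫ S.reductionIso'.hom = Q₂ ≫ S.reductionIso'.hom := by
    ext : 1
    refine pullback.hom_ext h ?_
    have e₁ : (Q₁ ≫ S.reductionIso'.hom).left ≫ pullback.snd S.model.total.hom (specResidueField v) =
        (specOver v.asIdeal.ResidueField L).hom := Over.w (Q₁ ≫ S.reductionIso'.hom)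
    have e₂ : (Q₂ ≫ S.reductionIso'.hom).left ≫ pullback.snd S.model.total.hom (specResidueField v) =
        (specOver v.asIdeal.ResidueField L).hom := Over.w (Q₂ ≫ S.reductionIso'.hom)
    exact e₁.trans e₂.symm
  exact (cancel_mono S.reductionIso'.hom).mp h'

end GoodReductionAt

end AbelianVariety

/-! ### §1 Frobenius commutes with morphisms of spectra of fields -/


/-- **The absolute Frobenius commutes with every morphism between spectra of fields** of exponential characteristic
`p` over a common base field `k`: `Spec Frobⁿ_L ≫ θ = θ ≫ Spec Frobⁿ_{L'}` for any `θ : Spec L → Spec L'` (Hartshorne IV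
Rem. 2.4.1: the absolute Frobenius is natural; the tree's `powEndo_comp`). [cite: Hartshorne1977, IV §2 Rem. 2.4.1] -/
theorem specMap_iterateFrobenius_comp {k : Type u} [Field k] (p : ℕ) [ExpChar k p] (n : ℕ) (L L' : Type u)
    [Field L] [Field L'] [Algebra k L] [Algebra k L'] [ExpChar L p] [ExpChar L' p] (θ : Spec (.of L) ⟶ Spec (.of L')) :
    Spec.map (CommRingCat.ofHom (iterateFrobenius L p n)) ≫ θ =
      θ ≫ Spec.map (CommRingCat.ofHom (iterateFrobenius L' p n)) := by
  rw [← AbelianVariety.absFrobeniusOver_specOver_eq (k := k) p n L,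
    ← AbelianVariety.absFrobeniusOver_specOver_eq (k := k) p n L']
  exact powEndo_comp _ _ _ θ _

/-! ### §2 The reduction point of the conjugate datum -/

namespace AbelianVariety

namespace GoodReductionAt

variable {K : Type} [Field K] [NumberField K] {A : AbelianVariety K} {v : HeightOneSpectrum (𝓞 K)}
  (R' : A.GoodReductionAt v) (γ : K ≃+* K)
  (γᵥ : valuationSubringAtPrime K v ≃+* valuationSubringAtPrime K v)
  (h₁ : (algebraMap (valuationSubringAtPrime K v) K).comp γᵥ.toRingHom =
    γ.toRingHom.comp (algebraMap (valuationSubringAtPrime K v) K))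
  (p n : ℕ) [ExpChar v.asIdeal.ResidueField p]
  (h₂ : (residueAt v).comp γᵥ.toRingHom = (iterateFrobenius v.asIdeal.ResidueField p n).comp (residueAt v))

/-- The `κ̄`-point underlying `π(x)` for a `κ̄`-point `x` of an abelian variety (unfolding `Hom.geomPointsMap` on
`Additive.ofMul`; by `rfl`). [cite: MumfordAV1970, §4 (functor of points)] -/
theorem toMul_geomPointsMap_ofMul {k : Type} [Field k] {C D : AbelianVariety k} (f : C ⟶ D)
    (P : C.Points (AlgebraicClosure k)) :
    Additive.toMul (Hom.geomPointsMap f (Additive.ofMul P)) = AlgPoints.map f.hom.hom.hom P := rfl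

set_option backward.isDefEq.respectTransparency false in
/-- **`(t^σ)~ = π(t̃)` on the special fibre — the reduction point of the conjugate datum is the relative Frobenius of the
reduction point.**  For ANY good-reduction datum `R'` of `A` at `v` (model `𝒳`), the conjugate datum
`R'.conjOfSquares γ γᵥ h₁ p n h₂` (model `𝒳 ⊗_{γᵥ} 𝓞ᵥ`, reduction `Ã^{(q)} = Ã.frobeniusTwist p n`, reduction isomorphism
`conjReductionIso`), a `κ(R)`-point `z` of the twisted model and a `κ(R)`-point `w` of `𝒳` such that `z` projects onto the
`Frobⁿ`-translate of `w` (`z ≫ pr_𝒳 = Spec Frobⁿ_{κ(R)} ≫ w`): the reduction point of `z` in `Ã^{(q)}(κ̄(v))` is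
`π(w̄)`, `π = F^{(n)}_{Ã/κ(v)}` the relative Frobenius ([Shimura1998] p. 129–130 «`Ã^f` … `(t^σ)~ = π(t̃)`»; Milne,
*Étale cohomology* VI §13 «`F` raises the coordinates of a point to the `q`-th power»).  The `ExpChar κ(R) p` instance is
an argument (a `Prop`, so any two agree). [cite: Shimura1998, §18.6 proof of Thm. 18.6, p. 129] -/
theorem reductionPoint_conjOfSquares_eq_relFrobenius
    [ExpChar (IsLocalRing.ResidueField (closureValuationSubring (v.adicCompletion K))) p]
    (z : residueFieldPoints (R'.conjOfSquares γ γᵥ h₁ p n h₂).model.total) (w : residueFieldPoints R'.model.total)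
    (hzw : z.left ≫ baseChangeHomFst γᵥ.toRingHom R'.model.total =
      Spec.map (CommRingCat.ofHom
        (iterateFrobenius (IsLocalRing.ResidueField (closureValuationSubring (v.adicCompletion K))) p n)) ≫ w.left) :
    Additive.ofMul ((R'.conjOfSquares γ γᵥ h₁ p n h₂).reductionPoint z) =
      Hom.geomPointsMap (R'.reduction.relFrobenius p n) (Additive.ofMul (R'.reductionPoint w)) := by
  haveI : ExpChar (geomResidueField v) p :=
    expChar_of_injective_algebraMap (algebraMap v.asIdeal.ResidueField (geomResidueField v)).injective p
  apply Additive.toMul.injective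
  rw [toMul_ofMul]
  erw [toMul_geomPointsMap_ofMul]
  symm
  refine R'.map_relFrobenius_eq_of_conjReductionIso γ γᵥ h₁ p n h₂ (R'.reductionPoint w)
    ((R'.conjOfSquares γ γᵥ h₁ p n h₂).reductionPoint z) ?_
  -- the point `w`, read in `𝒳` through the special fibre: `(Spec κ̄ ≅ Spec κ(R)) ≫ w`
  have hR : (R'.reductionPoint w).left ≫ R'.reductionIso.hom.left ≫ baseChangeHomFst (residueAt v) R'.model.total =
      (geomClosedPointIso v).inv.left ≫ (geomClosedPointIsoSpecResidueField v).inv.left ≫ w.left := by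
    rw [← Category.assoc]
    exact R'.reductionPoint_comp_reductionIso'_hom_left_comp_fst w
  -- the point `z`, read in `𝒳 ⊗_{γᵥ} 𝓞ᵥ` through the special fibre of the conjugate datum: `(Spec κ̄ ≅ Spec κ(R)) ≫ z`
  have hL : ((R'.conjOfSquares γ γᵥ h₁ p n h₂).reductionPoint z).left ≫ (conjReductionIso R' γ γᵥ h₁ p n h₂).hom.left ≫
      baseChangeHomFst (residueAt v) ((baseChangeHom γᵥ.toRingHom).obj R'.model.total) =
        (geomClosedPointIso v).inv.left ≫ (geomClosedPointIsoSpecResidueField v).inv.left ≫ z.left := by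
    rw [← Category.assoc]
    exact (R'.conjOfSquares γ γᵥ h₁ p n h₂).reductionPoint_comp_reductionIso'_hom_left_comp_fst z
  rw [reassoc_of% hL, hzw, hR]
  -- Frobenius commutes with `Spec κ̄ ≅ Spec κ(R)`
  have hθ := specMap_iterateFrobenius_comp (k := v.asIdeal.ResidueField) p n (geomResidueField v)
    (IsLocalRing.ResidueField (closureValuationSubring (v.adicCompletion K)))
    ((geomClosedPointIso v).inv.left ≫ (geomClosedPointIsoSpecResidueField v).inv.left)
  simp only [Category.assoc] at hθ
  rw [reassoc_of% hθ]

end GoodReductionAt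

end AbelianVariety

end Literature.AlgebraicGeometry.Motives

end
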